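import Summits.QuantumAdvantage.QuantumAdvantage.Theses.MobiusLadder
import Literature.Computability.Complexity.ACRealizeOver
import Literature.Computability.Cryptography.NaorReingoldTC0
import HarnessLib

/-!
# Crux `MobiusLadder.LiouvilleOrthogonalTC0` (stmt-QuantumAdvantage-1393): objects of the line `Sketch`
(card `multiplicative-xor-ladder`)

Definitions only (no proofs of stubs) used by the positive-side files of this crux, i.e. by the
registered stubs of the checked skeleton `Cruxes/LiouvilleOrthogonalTC0/Lines/Sketch.lean` (lead
`prover-line-stmt-QuantumAdvantage-1393-0`) and by its transfer theorem `stub_transfer`: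

* `TCFun n d s` — Boolean functions of `n` bits realizable over `tcBasis` at `acDepth ≤ d` with `≤ s`
  gates (the tree's realizability calculus `ACRealOver`; `ACRealOver.of_circuit`/`.toCircuit` convert
  to and from the crux's `Circuit (Fin n)`); `bits n u`, `ofBits x` (binary digits, LSB = index `0`,
  as in the crux);
* `IsLocal y z u` (`u ≠ 0` with all prime factors in `(y, z]`), the interval-local part
  `locPart y z N = ∏_{p ∣ N, y < p ≤ z} p^{v_p(N)}`, the PIECE `pieceSet n y z b θ` (the `(y,z]`-local
  `u < 2ⁿ` in the multiplicative box `b ≤ u < b(1+θ)`), and `lamBit u = [λ(u) = -1]`;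
* the line's hypothesis `LocalPieceHardness δ₀ κ Λ₀ A` (OPEN, breakthrough-type: constant-error
  hardness of `Ω mod 2` on prime-window pieces against poly-size constant-depth threshold circuits —
  a `TC⁰` average-case lower bound for a factoring-type function, subject to the route's
  `SeparationPrerequisites` barrier exactly as the crux is).  The line's theorem is the TRANSFER
  `(∀ A, LocalPieceHardness δ₀ κ Λ₀ A) → LiouvilleOrthogonalTC0` (hard-core + XOR inside `TC⁰` along
  the prime-interval factorisation): "at rung R2 the `∀ε`-law of Möbius randomness is free given
  constant-error hardness".

Side conditions of the hypothesis, each forced by a cheap counterexample (PICKED.md / skeleton):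
wide prime window `z ≥ y^{Λ₀}` (for a narrow window the size of a local `u` determines `Ω(u)`),
`b ≥ y^{2+κ}` (below `y²` every piece element is prime), `#U ≥ 2^{n/A}` (a tiny piece is computed by
a constant), `y ≥ 2^{n/A}` (no trial division).
Pattern: `Theorems/ArithStatLadderAcZeroRungDefs.lean`.

Skeleton v8 (lead `…-1393-c5-0`) adds the vocabulary of the SYMMETRIC-DIGITAL RUNG: the Liouville–Gelfond
sums `gelfondSum n α = Σ_{N<2ⁿ} λ(N) e(α s₂(N))` and the large-frequency hypothesis
`GelfondLiouvilleDecay` (Mauduit–Rivat type; in print for `Λ`, `μ`, not `λ`), under which `λ` is PROVED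
orthogonal to every Boolean function of the Hamming weight `s₂(N)` (`…SymmetricDigital.lean`).
-/

set_option linter.dupNamespace false -- D-0017: single-problem summit ⇒ `QuantumAdvantage.QuantumAdvantage` by design

noncomputable section

namespace Summit.QuantumAdvantage.QuantumAdvantage.Theorems.LiouvilleOrthogonalTC0

open Filter Finset
open Literature.Computability.Complexity

/-! ## Circuit-side vocabulary -/

/-- The `n` low binary digits of `u`, as a circuit input (`bits n u i = Nat.testBit u i`, the
crux's input convention). -/
def bits (n u : ℕ) : Fin n → Bool := fun i => Nat.testBit u i

/-- The number with binary digits `x` (inverse of `bits n` below `2ⁿ`). -/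
def ofBits {n : ℕ} (x : Fin n → Bool) : ℕ := ∑ i : Fin n, (x i).toNat * 2 ^ (i : ℕ)

/-- `TCFun n d s`: Boolean functions of `n` bits realizable over `tcBasis` (`∧`, `∨`, `¬`, `MAJ`
of any fan-in; negations free in the depth) with `acDepth ≤ d` and `≤ s` gates, in the tree's
realizability calculus `ACRealOver`. -/
def TCFun (n d s : ℕ) : Set ((Fin n → Bool) → Bool) := {g | ACRealOver tcBasis g d s}

/-- `ofBits (bits n u) = u mod 2ⁿ` (so `= u` for `u < 2ⁿ`): the circuit input of the dilated
tests of the transfer is read back as the number. [folklore] -/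
theorem ofBits_bits (n u : ℕ) : ofBits (bits n u) = u % 2 ^ n :=
  Literature.Computability.Cryptography.NRTC0.sum_testBit_toNat_mul u n

/-! ## Pieces -/

/-- `u` is `(y, z]`-LOCAL: `u ≠ 0` and every prime factor of `u` lies in `(y, z]` (`u = 1` allowed). -/
def IsLocal (y z u : ℕ) : Prop := u ≠ 0 ∧ ∀ p ∈ u.primeFactors, y < p ∧ p ≤ z

/-- `IsLocal` is decidable (a finite conjunction over `primeFactors`). -/
instance instDecidableIsLocal (y z u : ℕ) : Decidable (IsLocal y z u) := by
  unfold IsLocal; infer_instance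

/-- The `(y, z]`-local part of `N`: `∏_{p ∣ N, y < p ≤ z} p^{v_p(N)}` (`= 1` for `N = 0`). -/
def locPart (y z N : ℕ) : ℕ :=
  ∏ p ∈ N.primeFactors.filter (fun p => y < p ∧ p ≤ z), p ^ N.factorization p

/-- The PIECE `U(n; y, z; b, θ)`: the `(y, z]`-local numbers `u < 2ⁿ` in the multiplicative box
`b ≤ u < b(1+θ)`. -/
def pieceSet (n y z : ℕ) (b θ : ℝ) : Finset ℕ :=
  (range (2 ^ n)).filter fun u => IsLocal y z u ∧ b ≤ (u : ℝ) ∧ (u : ℝ) < b * (1 + θ)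

/-- The Boolean "`λ(u) = -1`" (i.e. `Ω(u)` odd, for `u ≠ 0`). -/
def lamBit (u : ℕ) : Bool := decide (ArithmeticFunction.liouville u = -1)

/-! ## The hypothesis of the line -/

/-- **`LocalPieceHardness δ₀ κ Λ₀ A` — constant-error hardness of the parity of `Ω` on prime-window
pieces (the line's hypothesis; OPEN, breakthrough-type).** For every depth `d` and size polynomial
`p`, for all large `n`, for every piece `U = pieceSet n y z b θ` with `y ≥ 2^{n/A}` (no trial
division), `z ≥ y^{Λ₀}` (wide prime window), `b ≥ y^{2+κ}` (not all prime), `n^{-A} ≤ θ ≤ 1`,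
`b(1+θ) ≤ 2ⁿ` and `#U ≥ 2^{n/A}`, every `g ∈ TCFun n d (p n)` disagrees with `[λ = -1]` on at least
`δ₀ · #U` elements of `U` (inputs read through their `n` low bits). -/
def LocalPieceHardness (δ₀ κ Λ₀ : ℝ) (A : ℕ) : Prop :=
  ∀ d : ℕ, ∀ p : Polynomial ℕ, ∀ᶠ n : ℕ in atTop, ∀ (y z : ℕ) (b θ : ℝ),
    (2 : ℝ) ^ ((n : ℝ) / (A : ℝ)) ≤ y → (y : ℝ) ^ Λ₀ ≤ z → (y : ℝ) ^ (2 + κ) ≤ b →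
    (n : ℝ) ^ (-(A : ℝ)) ≤ θ → θ ≤ 1 → b * (1 + θ) ≤ (2 : ℝ) ^ n →
    (2 : ℝ) ^ ((n : ℝ) / (A : ℝ)) ≤ #(pieceSet n y z b θ) →
    ∀ g ∈ TCFun n d (p.eval n),
      δ₀ * #(pieceSet n y z b θ) ≤ #((pieceSet n y z b θ).filter fun u => g (bits n u) ≠ lamBit u)

/-! ## The hypothesis of the symmetric-digital rung (skeleton v8, lead `…-1393-c5-0`) -/

/-- **The Liouville–Gelfond sum** on `n` binary digits at frequency `α`:
`gelfondSum n α = Σ_{N<2ⁿ} λ(N) e(α s₂(N))`, `e(t) = exp(2πit)`, `s₂(N) = #{i < n : bit_i(N) = 1}` the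
Hamming weight of the digits (Mauduit–Rivat's `Σ λ(n) e(α s_q(n))` for `q = 2`, `x = 2ⁿ`). -/
def gelfondSum (n : ℕ) (α : ℝ) : ℂ :=
  ∑ N ∈ Finset.range (2 ^ n), ((ArithmeticFunction.liouville N : ℤ) : ℂ) *
    Complex.exp (((2 * Real.pi * α *
      ((Finset.univ.filter fun i : Fin n => Nat.testBit N i = true).card : ℝ) : ℝ) : ℂ) * Complex.I)

/-- **`GelfondLiouvilleDecay` — the large-frequency Gelfond bound for `λ` (the hypothesis of the
symmetric-digital rung; believed PROVABLE by the Mauduit–Rivat type-I/II method, not a conjecture of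
breakthrough type).** For every `a > 0` and `B`, for all large `n`, `|Σ_{N<2ⁿ} λ(N) e(α s₂(N))| ≤ 2ⁿ/n^B`
whenever `n^{a−1/2} ≤ |α| ≤ 1/2`. The Mauduit–Rivat bound `≪ x^{1−c‖α‖²}` (uniform in `α`) implies it
(`n‖α‖² ≥ n^{2a}`); that bound is IN PRINT for `Λ` (C. Mauduit, J. Rivat, Ann. of Math. 171 (2010)
1591–1646, Thm 1) and for `μ` (C. Mauduit, J. Rivat, J. Eur. Math. Soc. 17 (2015) 2595–2642, Thm 2, with
MR2010 Lemmas 9 and 16 for the carry and Fourier properties of `e(α s₂)`), but NOT for `λ`; in the tree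
it would follow from the generic Vaughan identity `LiouvilleWalshVaughan.sum_liouville_mul_eq_vaughan`
plus MR2010's type-I (Prop. 2) and type-II (Prop. 1) estimates for `g = e(α s₂)`. The complementary SMALL
frequencies `|α| ≤ n^{a−1/2}` are PROVED (`gelfondSum_small`, file `…SymmetricDigital.lean`), and
`GelfondLiouvilleDecay →` "`λ ⊥` every Boolean function of `s₂(N)`" is PROVED
(`liouville_orthogonal_symmetric_of_gelfondDecay`). Never asserted; taken as a hypothesis only. -/
def GelfondLiouvilleDecay : Prop :=
  ∀ a : ℝ, 0 < a → ∀ B : ℕ, ∀ᶠ n : ℕ in atTop, ∀ α : ℝ,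
    (n : ℝ) ^ (a - 1 / 2) ≤ |α| → |α| ≤ 1 / 2 → ‖gelfondSum n α‖ ≤ (2 : ℝ) ^ n / (n : ℝ) ^ B

end Summit.QuantumAdvantage.QuantumAdvantage.Theorems.LiouvilleOrthogonalTC0
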